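import Summits.NavierStokesRegularity.FluidComputer.GateBudgetLeakCeiling
import Summits.NavierStokesRegularity.FluidComputer.GateBudgetSwingBand
import Summits.NavierStokesRegularity.FluidComputer.GateBudgetSwingTransferBack
import HarnessLib

/-!
# GateBudget part 103 — the swing transfer, III: phase locking and the headline band (§282–§283)

Cell `pub-fluidc`, blueprint seat bp1 (gen 38, seventh item); namespace
`Summit.NavierStokesRegularity.FluidComputer.GateBudget`, headline family
`RotorKnob.rotorCircuit K K¹⁰ ε ρ` (modes `0 = a` carrier, `1 = b` clock, `2 = c` trigger,
`3 = d` transfer, `4 = ã` output) from `delayInit`, trigger primitive `C` (`C' = c`). Imports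
part 74 (`GateBudgetLeakCeiling`: the co-rotating tracking bound of part 14 §43), part 100
(`GateBudgetSwingBand`: the band), part 102 (`GateBudgetSwingTransferBack`: the band law;
through it parts 99 and 101). HONEST FRAMING: a low prior, high value-of-information
experiment on Tao's machine paradigm; NOT a claim that NS blows up. Nothing here is about the
Navier–Stokes equations.

THE POINT (SPEC-INPUT-bp1 §BV–§BY, the swing law; fifth file). Parts 101/102 priced a swing
band for ANY member whose transfer mode is PHASE-LOCKED, `d² ≤ A(sin²(Φ + φ₀) + E)`,
`Φ = (C - C(r))/ρ²`. This file DISCHARGES that hypothesis for the headline member and puts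
the band law on the headline band of part 100. (§282) Part 14 §43 (in part 74's form
`transfer_sq_le_corot`) gives `d(u)² ≤ S² + 6L(T' - r)`, `S = sin Φ·a(r) + cos Φ·d(r)`,
`L = ε + ρ²e^{-K¹⁰} + Kã(T')`; with `|a(r)| ≤ 1`, `2|sin Φ cos Φ| ≤ 1` and `cos² ≤ 1` this
is the CRUDE LOCK `d(u)² ≤ a(r)²·sin²Φ + |d(r)| + d(r)² + 6L(T' - r)` — phase offset
`φ₀ = 0`, amplitude `A = a(r)²`, drift `E = (|d(r)| + d(r)² + 6L(T' - r))/a(r)²` (on the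
ladder `|d(r)| ≤ 4·10⁻⁶` (part 97) and `6L(T' - r) ≤ 102·242/K⁹ ≤ 4·10⁻⁷` at `K = 16`, so the
crude lock costs nothing visible).
(§283) On the unit lattice `ε = K¹⁰ρ²` (`k = 1`) and the symmetric band
`b(t₁) = (31/32)θε = -b(t₂)` of part 100 (kept ring `θ²ε² - ε²/10⁶ ≤ b² + c² ≤ θ²ε²
+ 2ε²/10⁶`, `|b| ≤ (31/32)θε` inside, `c > 0`), the hypotheses of part 102 §281 hold with
`R₂² = θ²ε² - ε²/10⁶ - ε²/K¹⁰`, `Q = θ²ε² - ε²/10⁶`, `κ = 9999/10000` (part 99 §276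
`band_kappa_headline`), so THE HEADLINE BAND LAW holds:
`ã(t₂) - ã(t₁) ≤ (K·a(r)²/(ε⁻¹K¹⁰κR₂))·((cos²ψ₁ + cos²ψ₂) cos α₁ + (|sin 2ψ₁| + |sin 2ψ₂|)
(1 - sin α₁) - (sin²ψ₁ + sin²ψ₂ + 2E₁)(log sin(α₁/2) - log cos(α₁/2)))` with
`α₁ = arccos((31/32)θε/R₂)`, `ψ₁ = Φ₁ - α₁`, `ψ₂ = -(α₁ + Φ₁ + ε⁻¹K¹⁰(C(t₂) - C(t₁)))`,
`E₁ = E + π(κ⁻¹ - 1)`; and the COEFFICIENT is `≤ (1 + 2/10⁴)·a(r)²/(θK⁹)` with the edge cosine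
in `[31/32, (31/32)(1 + 2/10⁵)]`.

* §282 `corot_sq_le_crude` (`S² ≤ a(r)² sin²Φ + |d(r)| + d(r)²`); `phase_lock_crude`
  (headline member, `K, ε ≥ 0`, `0 ≤ r ≤ u ≤ T'`, `a(r) ≠ 0`):
  `d(u)² ≤ a(r)²·(sin²((C(u) - C(r))/ρ²) + E)`, `E` as above.
* §283 `headline_band_radius` (the numbers of `R₂`: `0 < R₂`, `R₂² + ε²/K¹⁰ = Q`,
  `(1 - 2/10⁶)(θε)² ≤ R₂²`, `((31/32)θε)² < R₂²`, `(1 - 1/10⁵)θε ≤ R₂ ≤ θε`);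
  `swing_band_headline` (THE HEADLINE BAND LAW, displayed above); `swing_coef_headline`
  (`K·a(r)²/(ε⁻¹K¹⁰κR₂) ≤ (1 + 2/10⁴)·a(r)²/(θK⁹)` and
  `31/32 ≤ (31/32)θε/R₂ ≤ (31/32)(1 + 2/10⁵)`).

HONEST LIMITS. (i) The PRICE is still symbolic in `ψ₁, ψ₂, α₁`: the windows
(`Φ₁ ∈ [0.2480, 0.2561]` from part 100's climb dose, `α₁ ∈ [0.2499, 0.2510]`,
`|ψ₂ + ψ₁ + π| ≤ 3·10⁻⁴` from part 99's two angle laws, `-log tan(α₁/2) ≤ 2.08`) and the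
number `≈ 1.97·a(r)²/(θK⁹)` are part 104; (ii) `k = 1` only; (iii) the pulse ceiling `U₁`
and the ladder plumbing are parts 105–106 — until then `U = 7/2 + k²/3` stands and the
factor `≈ 2` at `K = 16` is a FORECAST; (iv) nothing about Navier–Stokes.
[cite: Tao2016AveragedNS, §5.5 Theorem 5.3, (5.5), (b-eq), (c-eq), (d-eq), (ta-eq),
(energy-con)]
-/

noncomputable section

namespace Summit.NavierStokesRegularity.FluidComputer.GateBudget

open Real Set Filter Topology
open Literature.Analysis.FluidPDE.Tao2016AveragedNS

variable {K M ε ρ : ℝ} {X : ℝ → Fin 5 → ℝ} {C : ℝ → ℝ}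

/-! ## §282 The crude phase lock of the transfer mode -/

/-- §282(a) `(sin Φ·a + cos Φ·d)² ≤ a²·sin²Φ + |d| + d²` for `|a| ≤ 1`
(`2 sin Φ cos Φ·a·d = sin 2Φ·a·d ≤ |d|`, `cos²Φ·d² ≤ d²`). [derived: this file] -/
theorem corot_sq_le_crude {a d φ : ℝ} (ha : |a| ≤ 1) :
    (sin φ * a + cos φ * d) ^ 2 ≤ a ^ 2 * sin φ ^ 2 + |d| + d ^ 2 := by
  have h2 : 2 * (sin φ * a) * (cos φ * d) ≤ |d| := by
    have e : 2 * (sin φ * a) * (cos φ * d) = sin (2 * φ) * (a * d) := by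
      rw [sin_two_mul]; ring
    rw [e]
    calc sin (2 * φ) * (a * d) ≤ |sin (2 * φ) * (a * d)| := le_abs_self _
      _ = |sin (2 * φ)| * (|a| * |d|) := by rw [abs_mul, abs_mul]
      _ ≤ 1 * (1 * |d|) :=
          mul_le_mul (abs_sin_le_one _) (mul_le_mul_of_nonneg_right ha (abs_nonneg _))
            (by positivity) zero_le_one
      _ = |d| := by ring
  have h3 : cos φ ^ 2 * d ^ 2 ≤ d ^ 2 := mul_le_of_le_one_left (sq_nonneg _) (cos_sq_le_one φ)
  have e : (sin φ * a + cos φ * d) ^ 2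
      = a ^ 2 * sin φ ^ 2 + 2 * (sin φ * a) * (cos φ * d) + cos φ ^ 2 * d ^ 2 := by ring
  rw [e]
  linarith only [h2, h3]

/-- §282(b) THE CRUDE PHASE LOCK (headline member `M = K¹⁰`, `K, ε ≥ 0`, `0 ≤ r ≤ u ≤ T'`,
`a(r) ≠ 0`): `d(u)² ≤ a(r)²·(sin²((C(u) - C(r))/ρ²) + E)` with
`E = (|d(r)| + d(r)² + 6(ε + ρ²e^{-K¹⁰} + Kã(T'))(T' - r))/a(r)²` — the phase-locking
hypothesis of parts 101/102 with `φ₀ = 0`, `A = a(r)²`.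
[derived: part 74 `transfer_sq_le_corot` (part 14 §43); this file §282(a)] -/
theorem phase_lock_crude
    (hX : ∀ t, HasDerivAt X (RotorKnob.rotorCircuit K (K ^ 10) ε ρ (X t)) t)
    (h0 : X 0 = delayInit) (hC : ∀ t, HasDerivAt C (X t 2) t) (hK : 0 ≤ K) (hε : 0 ≤ ε)
    {r u T' : ℝ} (hr : 0 ≤ r) (hru : r ≤ u) (huT : u ≤ T') (ha : X r 0 ≠ 0) :
    X u 3 ^ 2 ≤ X r 0 ^ 2 * (sin ((C u - C r) / ρ ^ 2) ^ 2
      + (|X r 3| + X r 3 ^ 2 + 6 * (ε + ρ ^ 2 * exp (-K ^ 10) + K * X T' 4) * (T' - r))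
        / X r 0 ^ 2) := by
  have hcor := transfer_sq_le_corot hX h0 hC hK hε hr hru huT
  have hS := corot_sq_le_crude (φ := (C u - C r) / ρ ^ 2) (d := X r 3)
    (RotorKnob.traj_abs_le_one hX h0 r 0)
  have ha2 : X r 0 ^ 2 ≠ 0 := pow_ne_zero 2 ha
  rw [mul_add, mul_div_cancel₀ _ ha2]
  linarith only [hcor, hS]

/-! ## §283 The headline band -/

/-- §283(a) THE NUMBERS OF THE BAND RADIUS (`K ≥ 16`, `ε > 0`, `θ ≥ 5/4`,
`R₂ = √(θ²ε² - ε²/10⁶ - ε²/K¹⁰)`): `0 < R₂`, `R₂² + ε²/K¹⁰ = θ²ε² - ε²/10⁶`,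
`(1 - 2/10⁶)(θε)² ≤ R₂²`, `((31/32)θε)² < R₂²`, `(1 - 1/10⁵)θε ≤ R₂ ≤ θε`.
[derived: this file (numerics)] -/
theorem headline_band_radius (hK : 16 ≤ K) (hε : 0 < ε) {θ R₂ : ℝ} (hθ1 : 5 / 4 ≤ θ)
    (hR₂ : R₂ = √(θ ^ 2 * ε ^ 2 - ε ^ 2 / 10 ^ 6 - ε ^ 2 / K ^ 10)) :
    0 < R₂ ∧ R₂ ^ 2 + ε ^ 2 / K ^ 10 = θ ^ 2 * ε ^ 2 - ε ^ 2 / 10 ^ 6 ∧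
      (1 - 2 / 10 ^ 6) * (θ * ε) ^ 2 ≤ R₂ ^ 2 ∧ (31 / 32 * θ * ε) ^ 2 < R₂ ^ 2 ∧
      (1 - 1 / 10 ^ 5) * (θ * ε) ≤ R₂ ∧ R₂ ≤ θ * ε := by
  have hK10 : (10 : ℝ) ^ 12 ≤ K ^ 10 := by
    have h : (16 : ℝ) ^ 10 ≤ K ^ 10 := pow_le_pow_left₀ (by norm_num) hK 10
    nlinarith only [h]
  have hKi : ε ^ 2 / K ^ 10 ≤ ε ^ 2 / 10 ^ 12 :=
    div_le_div_of_nonneg_left (sq_nonneg ε) (by norm_num) hK10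
  have hKi0 : 0 ≤ ε ^ 2 / K ^ 10 := div_nonneg (sq_nonneg ε) (le_trans (by norm_num) hK10)
  have hθ0 : 0 < θ := by linarith
  have hθε : 0 < θ * ε := mul_pos hθ0 hε
  have he2 : 0 < ε ^ 2 := by positivity
  have hθsq : (5 / 4 : ℝ) ^ 2 ≤ θ ^ 2 := pow_le_pow_left₀ (by norm_num) hθ1 2
  have hθe : 25 / 16 * ε ^ 2 ≤ θ ^ 2 * ε ^ 2 := by nlinarith only [hθsq, he2]
  have hme : (θ * ε) ^ 2 = θ ^ 2 * ε ^ 2 := mul_pow θ ε 2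
  have hme2 : (31 / 32 * θ * ε) ^ 2 = (31 / 32) ^ 2 * (θ ^ 2 * ε ^ 2) := by ring
  have hin : 0 ≤ θ ^ 2 * ε ^ 2 - ε ^ 2 / 10 ^ 6 - ε ^ 2 / K ^ 10 := by
    linarith only [hKi, hθe, he2]
  have hsq : R₂ ^ 2 = θ ^ 2 * ε ^ 2 - ε ^ 2 / 10 ^ 6 - ε ^ 2 / K ^ 10 := by
    rw [hR₂, sq_sqrt hin]
  have hR0 : 0 ≤ R₂ := by rw [hR₂]; exact sqrt_nonneg _
  have hlo2 : (1 - 2 / 10 ^ 6) * (θ * ε) ^ 2 ≤ R₂ ^ 2 := by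
    rw [hsq, hme]; linarith only [hKi, hθe, he2]
  have hband : (31 / 32 * θ * ε) ^ 2 < R₂ ^ 2 := by
    rw [hsq, hme2]; linarith only [hKi, hθe, he2]
  have hlo1 : (1 - 1 / 10 ^ 5) * (θ * ε) ≤ R₂ := by
    have h : ((1 - 1 / 10 ^ 5) * (θ * ε)) ^ 2 ≤ R₂ ^ 2 := by nlinarith only [hlo2, hθε]
    exact (abs_le_of_sq_le_sq' h hR0).2
  have hhi : R₂ ≤ θ * ε := by
    have h : R₂ ^ 2 ≤ (θ * ε) ^ 2 := by rw [hsq]; nlinarith only [hKi0, hε]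
    exact (abs_le_of_sq_le_sq' h hθε.le).2
  have hpos : 0 < R₂ := lt_of_lt_of_le (by positivity) hlo1
  exact ⟨hpos, by rw [hsq]; ring, hlo2, hband, hlo1, hhi⟩

/-- §283(b) THE HEADLINE BAND LAW (headline member `K ≥ 16`, `ε > 0`, UNIT LATTICE
`ε = K¹⁰ρ²` (`k = 1`), `θ ≥ 5/4`; a pulse start `r ≥ 0` and an end `T' ≤ r + 242/K⁹` with the
kept ring `θ²ε² - ε²/10⁶ ≤ b² + c² ≤ θ²ε² + 2ε²/10⁶` and `c > 0` on `[r, T']`, `a(r) ≠ 0`; a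
symmetric band `r ≤ t₁ ≤ t₂ ≤ T'`, `b(t₁) = (31/32)θε = -b(t₂)`, `|b| ≤ (31/32)θε` on
`[t₁, t₂]` — part 100 §277 `pulse_swing_band` supplies all of this; abbreviation hypotheses
`R₂ = √(θ²ε² - ε²/10⁶ - ε²/K¹⁰)`, `E` of §282, `α₁ = arccos((31/32)θε/R₂)`,
`ψ₁ = (C(t₁) - C(r))/ρ² - α₁`, `ψ₂ = -(α₁ + (C(t₁) - C(r))/ρ² + ε⁻¹K¹⁰(C(t₂) - C(t₁)))`,
`E₁ = E + π((9999/10000)⁻¹ - 1)`): `ã(t₂) - ã(t₁) ≤ (K·a(r)²/(ε⁻¹K¹⁰(9999/10000)R₂))·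
((cos²ψ₁ + cos²ψ₂) cos α₁ + (|sin 2ψ₁| + |sin 2ψ₂|)(1 - sin α₁) - (sin²ψ₁ + sin²ψ₂ + 2E₁)
(log sin(α₁/2) - log cos(α₁/2)))`.
[derived: part 99 §276; part 102 §281; this file §282, §283(a)] -/
theorem swing_band_headline
    (hX : ∀ t, HasDerivAt X (RotorKnob.rotorCircuit K (K ^ 10) ε ρ (X t)) t)
    (h0 : X 0 = delayInit) (hC : ∀ t, HasDerivAt C (X t 2) t) (hK : 16 ≤ K) (hε : 0 < ε)
    (hlat : ε = K ^ 10 * ρ ^ 2) {r t₁ t₂ T' θ : ℝ} (hr : 0 ≤ r) (hrt : r ≤ t₁) (ht : t₁ ≤ t₂)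
    (htT : t₂ ≤ T') (hθ1 : 5 / 4 ≤ θ) (ha : X r 0 ≠ 0)
    (hring : ∀ u ∈ Icc r T', θ ^ 2 * ε ^ 2 - ε ^ 2 / 10 ^ 6 ≤ X u 1 ^ 2 + X u 2 ^ 2 ∧
      X u 1 ^ 2 + X u 2 ^ 2 ≤ θ ^ 2 * ε ^ 2 + 2 * ε ^ 2 / 10 ^ 6)
    (hpos : ∀ u ∈ Icc r T', 0 < X u 2) (hb1 : X t₁ 1 = 31 / 32 * θ * ε)
    (hb2 : X t₂ 1 = -(31 / 32 * θ * ε))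
    (hband : ∀ u ∈ Icc t₁ t₂, -(31 / 32 * θ * ε) ≤ X u 1 ∧ X u 1 ≤ 31 / 32 * θ * ε)
    {R₂ E α₁ ψ₁ ψ₂ E₁ : ℝ} (hR₂ : R₂ = √(θ ^ 2 * ε ^ 2 - ε ^ 2 / 10 ^ 6 - ε ^ 2 / K ^ 10))
    (hE : E = (|X r 3| + X r 3 ^ 2 + 6 * (ε + ρ ^ 2 * exp (-K ^ 10) + K * X T' 4) * (T' - r))
      / X r 0 ^ 2)
    (hα₁ : α₁ = arccos (31 / 32 * θ * ε / R₂)) (hψ₁ : ψ₁ = (C t₁ - C r) / ρ ^ 2 - α₁)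
    (hψ₂ : ψ₂ = -(α₁ + (C t₁ - C r) / ρ ^ 2 + ε⁻¹ * K ^ 10 * (C t₂ - C t₁)))
    (hE₁ : E₁ = E + π * ((9999 / 10000 : ℝ)⁻¹ - 1)) :
    X t₂ 4 - X t₁ 4 ≤ K * X r 0 ^ 2 / (ε⁻¹ * K ^ 10 * (9999 / 10000) * R₂) *
      ((cos ψ₁ ^ 2 + cos ψ₂ ^ 2) * cos α₁ + (|sin (2 * ψ₁)| + |sin (2 * ψ₂)|) * (1 - sin α₁)
        - (sin ψ₁ ^ 2 + sin ψ₂ ^ 2 + 2 * E₁) * (log (sin (α₁ / 2)) - log (cos (α₁ / 2)))) := by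
  have hK0 : (0 : ℝ) < K := by linarith
  have hM : (0 : ℝ) < K ^ 10 := by positivity
  obtain ⟨hRpos, hRQ, hRlo2, hRband, -, -⟩ := headline_band_radius hK hε hθ1 hR₂
  have hθ0 : 0 < θ := by linarith
  have hθε : 0 < θ * ε := mul_pos hθ0 hε
  have hlat1 : ε⁻¹ * K ^ 10 * ρ ^ 2 = 1 := by
    rw [mul_assoc, ← hlat]; exact inv_mul_cancel₀ hε.ne'
  have hrT : r ≤ T' := hrt.trans (ht.trans htT)
  have hsub : ∀ u ∈ Icc t₁ t₂, u ∈ Icc r T' := fun u hu => ⟨hrt.trans hu.1, hu.2.trans htT⟩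
  -- the hypotheses of the band law on `[t₁, t₂]`
  have hQ : R₂ ^ 2 + ε ^ 2 / K ^ 10 ≤ θ ^ 2 * ε ^ 2 - ε ^ 2 / 10 ^ 6 := hRQ.le
  have hring2 : ∀ u ∈ Icc t₁ t₂, θ ^ 2 * ε ^ 2 - ε ^ 2 / 10 ^ 6 ≤ X u 1 ^ 2 + X u 2 ^ 2 :=
    fun u hu => (hring u (hsub u hu)).1
  have hbsq : ∀ u ∈ Icc t₁ t₂, X u 1 ^ 2 ≤ (31 / 32 * θ * ε) ^ 2 := by
    intro u hu
    obtain ⟨h1, h2⟩ := hband u hu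
    exact sq_le_sq' h1 h2
  have hband2 : ∀ u ∈ Icc t₁ t₂, X u 1 ^ 2 < R₂ ^ 2 :=
    fun u hu => (hbsq u hu).trans_lt hRband
  have hκ : ∀ u ∈ Icc t₁ t₂, 9999 / 10000 * X u 2 ≤ √(R₂ ^ 2 - X u 1 ^ 2) := by
    intro u hu
    have hup := (hring u (hsub u hu)).2
    refine band_kappa_headline hθ1 hε hRlo2 ?_ ?_
    · rw [← mul_pow, ← mul_assoc]; exact hbsq u hu
    · rw [mul_pow]; exact hup
  have hpos2 : ∀ u ∈ Icc t₁ t₂, 0 ≤ X u 2 := fun u hu => (hpos u (hsub u hu)).le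
  have hsym : X t₂ 1 = -X t₁ 1 := by rw [hb1, hb2]
  -- the crude phase lock (§282) on the band
  have hd : ∀ u ∈ Icc t₁ t₂, X u 3 ^ 2 ≤ X r 0 ^ 2 * (sin ((C u - C r) / ρ ^ 2 + 0) ^ 2 + E) := by
    intro u hu
    rw [add_zero, hE]
    exact phase_lock_crude hX h0 hC hK0.le hε.le hr (hrt.trans hu.1) (hu.2.trans htT) ha
  have hE0 : 0 ≤ E := by
    rw [hE]
    have hT0 : 0 ≤ T' := hr.trans hrT
    have he := RotorKnob.e_nonneg hX h0 hK0.le hT0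
    have hτ : 0 ≤ T' - r := by linarith
    positivity
  have hα₁' : α₁ = arccos (X t₁ 1 / R₂) := by rw [hα₁, hb1]
  have hψ₁' : ψ₁ = (C t₁ - C r) / ρ ^ 2 + 0 - α₁ := by rw [hψ₁, add_zero]
  have hψ₂' : ψ₂ = -(α₁ + ((C t₁ - C r) / ρ ^ 2 + 0) + ε⁻¹ * K ^ 10 * (C t₂ - C t₁)) := by
    rw [hψ₂, add_zero]
  exact swing_transfer_band hX h0 hC hK0.le hε hM hlat1 ht hRpos hQ (by norm_num) (by norm_num)
    (sq_nonneg _) hE0 hring2 hband2 hκ hpos2 hsym hd hα₁' hψ₁' hψ₂' hE₁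

/-- §283(c) THE COEFFICIENT AND THE EDGE COSINE (`K ≥ 16`, `ε > 0`, `θ ≥ 5/4`, `R₂` as in
§283(a); no lattice needed, `K/(ε⁻¹K¹⁰) = ε/K⁹`): `K·A/(ε⁻¹K¹⁰(9999/10000)R₂)
≤ (1 + 2/10⁴)·A/(θK⁹)` for `A ≥ 0` (used with `A = a(r)² ≤ 1`), and
`31/32 ≤ (31/32)θε/R₂ ≤ (31/32)(1 + 2/10⁵)` (the edge cosine `cos α₁`).
[derived: this file §283(a) (numerics)] -/
theorem swing_coef_headline (hK : 16 ≤ K) (hε : 0 < ε) {θ R₂ A : ℝ} (hθ1 : 5 / 4 ≤ θ)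
    (hA : 0 ≤ A) (hR₂ : R₂ = √(θ ^ 2 * ε ^ 2 - ε ^ 2 / 10 ^ 6 - ε ^ 2 / K ^ 10)) :
    K * A / (ε⁻¹ * K ^ 10 * (9999 / 10000) * R₂) ≤ (1 + 2 / 10 ^ 4) * A / (θ * K ^ 9) ∧
      31 / 32 ≤ 31 / 32 * θ * ε / R₂ ∧ 31 / 32 * θ * ε / R₂ ≤ 31 / 32 * (1 + 2 / 10 ^ 5) := by
  have hK0 : (0 : ℝ) < K := by linarith
  obtain ⟨hRpos, -, -, -, hRlo, hRhi⟩ := headline_band_radius hK hε hθ1 hR₂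
  have hθ0 : 0 < θ := by linarith
  have hθε : 0 < θ * ε := mul_pos hθ0 hε
  refine ⟨?_, ?_, ?_⟩
  · -- `K·A/(ε⁻¹K¹⁰κR₂) = A·ρ²K/(κR₂)` and `ρ² = ε/K¹⁰`, `R₂ ≥ (1 - 10⁻⁵)θε`
    have e : K * A / (ε⁻¹ * K ^ 10 * (9999 / 10000) * R₂)
        = A * ε / ((9999 / 10000) * R₂ * K ^ 9) := by
      field_simp
    rw [e, div_le_div_iff₀ (by positivity) (by positivity)]
    have h1 : A * ε * (θ * K ^ 9) = A * K ^ 9 * (θ * ε) := by ring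
    have h2 : (1 + 2 / 10 ^ 4) * A * ((9999 / 10000) * R₂ * K ^ 9)
        = A * K ^ 9 * ((1 + 2 / 10 ^ 4) * (9999 / 10000) * R₂) := by ring
    rw [h1, h2]
    refine mul_le_mul_of_nonneg_left ?_ (by positivity)
    nlinarith only [hRlo, hθε]
  · rw [le_div_iff₀ hRpos]
    nlinarith only [hRhi, hθε]
  · rw [div_le_iff₀ hRpos]
    nlinarith only [hRlo, hθε]

end Summit.NavierStokesRegularity.FluidComputer.GateBudget
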